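import Literature.AlgebraicTopology.SingularHomology.AsphericalGroupCohomology
import Literature.AlgebraicTopology.SingularHomology.OrientationProofs
import Literature.AlgebraicTopology.SingularHomology.FundamentalClassExistence
import Literature.AlgebraicTopology.SingularHomology.UniversalCoefficientsField
import Literature.AlgebraicTopology.Homotopy.ManifoldStronglyLocallyContractible
import Literature.Topology.FourManifolds.IntersectionLatticeOrientationProofs
import Mathlib.Algebra.Field.ULift
import Mathlib.Algebra.Field.ZMod
import HarnessLib

/-!
# `H³(π₁(N); 𝔽₂) ≠ 0` for a closed orientable aspherical `3`-manifold `N`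

Topic `Literature/Topology/FourManifolds`.  M. Aschenbrenner, S. Friedl, H. Wilton, *3-Manifold
Groups* (EMS 2015; arXiv:1205.0202v3), proof of Prop. 9.29 (§9.13): "`H³(π₁(N₁); ℤ/2) ≅
H³(N₁; ℤ/2) ≅ ℤ/2`" for `N₁` closed and aspherical (`N₁ ≃ K(π₁N₁, 1)`; §9.3: "the fundamental
group of any closed, orientable, aspherical `n`-manifold is a `PD_n`-group").  This is the
TOPOLOGICAL input `hH3` of
`Literature.Topology.FourManifolds.not_lift_fundamentalGroup_of_aspherical_of_good_of_H3_ne_zero`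
(`AsphericalThreeManifoldGroupNotProjectiveProofs.lean`), now PROVED:

* `nontrivial_singularCohomology_top` — for a closed connected `F`-oriented topological
  `n`-manifold and a field `F`, `Hⁿ(X; F) ≠ 0` (`Hₙ(X; F) ≅ F`, Hatcher Thm. 3.26(a), tree
  `nonempty_singularHomology_top_iso_holds`; universal coefficients over a field, Hatcher Thm. 3.2,
  tree `kroneckerPairing_bijective_of_field`);
* **`nontrivial_groupCohomology_H3_of_aspherical`** — for a closed, connected, orientable,
  aspherical smooth `3`-manifold `Z`, `H³(π₁(Z, z); 𝔽₂) ≠ 0` with `𝔽₂ = ULift (ZMod 2)` and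
  Mathlib's `groupCohomology` of the trivial representation: the `K(π,1)` comparison
  `H³(π₁Z; 𝔽₂) ≅ H³(Z; 𝔽₂)` (`groupCohomologyFundamentalGroupIso`, Brown Prop. II.4.1, proved in
  `AsphericalGroupCohomology.lean` from the universal cover and the free resolution `C_•(Z̃)`),
  smooth orientability ⇒ `ℤ`- ⇒ `𝔽₂`-orientability (tree
  `isOrientableOver_int_of_isOrientable_holds`, `isOrientableOver_of_int_holds`), and the previous
  item.

## References

* M. Aschenbrenner, S. Friedl, H. Wilton, *3-Manifold Groups*, EMS Series of Lectures in
  Mathematics 20 (2015), §9.3, §9.13 proof of Prop. 9.29. [AschenbrennerFriedlWilton2015]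
* K. S. Brown, *Cohomology of Groups*, GTM 87, Springer 1982, Prop. II.4.1. [Brown1982CohomologyGroups]
* A. Hatcher, *Algebraic Topology*, CUP 2002, Thm. 3.2, Thm. 3.26. [HatcherAT2002]
-/

noncomputable section

open CategoryTheory CategoryTheory.Limits
open scoped Manifold ContDiff Topology

universe u v

namespace Literature.Topology.FourManifolds

open Literature.AlgebraicTopology.SingularHomology Literature.AlgebraicTopology.Homotopy

/-- **The top cohomology of a closed connected oriented manifold over a field is non-zero**:
for a field `F` and a closed connected `F`-oriented topological `n`-manifold `X`, `Hⁿ(X; F) ≠ 0`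
— `Hₙ(X; F) ≅ F` (Hatcher 2002, Thm. 3.26(a)) and `Hⁿ(X; F) ≅ Hom_F(Hₙ(X; F), F)` (Thm. 3.2 over
a field). [cite: HatcherAT2002, Thm. 3.26(a) and Thm. 3.2] -/
theorem nontrivial_singularCohomology_top (F : Type v) [Field F] (X : Type u) [TopologicalSpace X]
    [CompactSpace X] [T2Space X] {n : ℕ} [ChartedSpace (EuclideanSpace ℝ (Fin n)) X]
    [ConnectedSpace X] (μ : HomologicalOrientation F X n) :
    Nontrivial (singularCohomology F F X n) := by
  obtain ⟨e⟩ := nonempty_singularHomology_top_iso_holds (R := F) (X := X) n μ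
  let ℓ : singularHomology F F X n →ₗ[F] F :=
    (ULift.moduleEquiv : ULift.{u} F ≃ₗ[F] F).toLinearMap ∘ₗ e.toLinearEquiv.toLinearMap
  have hℓ : ℓ (e.toLinearEquiv.symm (ULift.up 1)) = 1 := by
    change (ULift.moduleEquiv : ULift.{u} F ≃ₗ[F] F)
        (e.toLinearEquiv (e.toLinearEquiv.symm (ULift.up 1))) = 1
    rw [LinearEquiv.apply_symm_apply]
    rfl
  obtain ⟨a, ha⟩ := (kroneckerPairing_bijective_of_field F X n).2 ℓ
  refine nontrivial_of_ne a 0 ?_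
  rintro rfl
  rw [map_zero] at ha
  have h := congrArg (fun f : singularHomology F F X n →ₗ[F] F => f (e.toLinearEquiv.symm (ULift.up 1))) ha
  simp only [LinearMap.zero_apply] at h
  rw [hℓ] at h
  exact zero_ne_one h

/-- **`H³(π₁(Z); 𝔽₂) ≠ 0` for a closed, connected, orientable, aspherical `3`-manifold `Z`**
(Aschenbrenner–Friedl–Wilton 2015, proof of Prop. 9.29: "`H³(π₁(N₁); ℤ/2) ≅ H³(N₁; ℤ/2) ≅ ℤ/2`",
`N₁` closed aspherical hence a `K(π₁N₁, 1)`), in the form of hypothesis `hH3` of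
`not_lift_fundamentalGroup_of_aspherical_of_good_of_H3_ne_zero`: `𝔽₂ = ULift (ZMod 2)` in the
universe of `Z`, `H³ = groupCohomology (Rep.trivial 𝔽₂ (π₁(Z, z)) 𝔽₂) 3`.  Proof:
`H³(π₁Z; 𝔽₂) ≅ H³(Z; 𝔽₂)` (`groupCohomologyFundamentalGroupIso`: `Z̃` is a free acyclic
`π₁`-space, Brown Prop. II.4.1) and `H³(Z; 𝔽₂) ≠ 0` (`nontrivial_singularCohomology_top`, the
orientation coming from the smooth one via `isOrientableOver_int_of_isOrientable_holds`).
[cite: AschenbrennerFriedlWilton2015, §9.13 Prop. 9.29 (proof) and §9.3; arXiv:1205.0202v3 numbering] -/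
theorem nontrivial_groupCohomology_H3_of_aspherical (Z : Type u) [TopologicalSpace Z] [T2Space Z]
    [SecondCountableTopology Z] [ChartedSpace (EuclideanSpace ℝ (Fin 3)) Z] [IsManifold (𝓡 3) ∞ Z]
    [CompactSpace Z] [ConnectedSpace Z] (hZ : IsOrientable (𝓡 3) Z) (z : Z)
    (hasph : ∀ n : ℕ, 2 ≤ n → Subsingleton (HomotopyGroup (Fin n) Z z)) :
    Nontrivial (groupCohomology
      (Rep.trivial (ULift.{u} (ZMod 2)) (FundamentalGroup Z z) (ULift.{u} (ZMod 2))) 3) := by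
  haveI : LocallyPathConnectedSpace Z :=
    ChartedSpace.locallyPathConnectedSpace (EuclideanSpace ℝ (Fin 3)) Z
  haveI : PathConnectedSpace Z := pathConnectedSpace_iff_connectedSpace.2 inferInstance
  haveI : StronglyLocallyContractibleSpace Z :=
    stronglyLocallyContractibleSpace_of_chartedSpace_normedSpace (EuclideanSpace ℝ (Fin 3)) Z
  obtain ⟨μℤ⟩ := isOrientableOver_int_of_isOrientable_holds Z hZ
  obtain ⟨μ⟩ := isOrientableOver_of_int_holds (R := ULift.{u} (ZMod 2)) Z ⟨μℤ⟩
  haveI := nontrivial_singularCohomology_top (ULift.{u} (ZMod 2)) Z μ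
  exact (groupCohomologyFundamentalGroupIso z (ULift.{u} (ZMod 2)) (ULift.{u} (ZMod 2)) hasph
    3).toLinearEquiv.symm.injective.nontrivial

end Literature.Topology.FourManifolds
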